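import Summits.ABC.IUTFork.Repair.RHReqsideWeightLaws
import HarnessLib

/-!
# Round-3 AXIS D1 (BED OPTIMUM) — the kernel face of «within-place financing closes a place iff its NET SLACK is nonnegative»,
# the antitonicity of the net slack in the pilot law, and hence the DOWN-SET property of the κ-scan; worked place FREY `p = 7`, `l = 107`

abc-iut cell, rung LADDER-ABC:A2.RESCUE.H; seat abc-iut-rh2-xi-2 g12 (KEY `D1-REDERIVE-FREY133`: second engine of the FREY133 bed optimum; reports
`HOME/abc-iut-rh2-xi-2/D1X/REPORT-D1X-v2.md`; desk abc-iut-rh-lead g5, ruling R77). Currency = TOPT-LP-SPEC v1.2 §S2/§S3 and REQB-SPEC v0.2 §1/§6(b),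
written over the k1-cell of `Repair/RHReqsideWeightLaws.lean` (`Cell f den e m δ r_in r_out j :⟺ e·⌊(f(j)m − den(jδ + (j+1)r_in))/(den·e)⌋ ≤ m − (j+1)r_out`).
* §1 `margin f den e m δ r_in r_out j := m − (j+1)r_out − e·⌊(f(j)m − den(jδ + (j+1)r_in))/(den·e)⌋` — the engines' «margin_j» (price minus demand of the cell);
  `Cell ⟺ 0 ≤ margin` (`cell_iff_margin_nonneg`); PILOT ANTITONICITY of the margin itself (`margin_antitone`: `f(j) ≤ g(j)`, `m ≥ 0 ⟹ margin g ≤ margin f`),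
  refining `ReqsideWeightLaws.cell_of_le_of_cell` from the sign to the value.
* §2 `placeNet f … n := Σ_{j=1}^{n} margin_j` = the place's PRICE MASS minus its TRIVIAL MASS (`PP_w − MM_w` of LP-SPEC §S2: `priceSum_sub_demandSum_eq_placeNet`);
  `placeNet_antitone` in the law; «the place CLOSES WITHIN» :⟺ `0 ≤ placeNet` = «the place keeps its whole mass under EX information + WITHIN-place financing»
  (tier L1a per place: `kept_w = min(MM_w, PP_w) = MM_w ⟺ 0 ≤ PP_w − MM_w`, `min_mass_price_eq_mass_iff`; shortfall `MM_w − kept_w = (MM_w − PP_w)⁺`,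
  `mass_sub_min_eq_posPart`); THE DOWN-SET THEOREM `closesWithin_of_le` / `closesWithin_lawPow_of_le`: if a place closes under the law `g` it closes under
  every pointwise-smaller law `f ≤ g` on its labels — in particular under `⌈j^{a/2}⌉` for every `a ≤ b` once it closes under `⌈j^{b/2}⌉`. This is the kernel face
  of the two engines' observation «the κ-scan one-flags are a down-set in κ on 133/133 FREY data» (rh-kit-1 PASS 15 j278649; rh2-xi-2 D1X-kappascan-v411.tsv
  28895d450b351a57), which makes `κ⋆(T) :=` the largest grid exponent at which every place of `T` closes well defined.
* §3 WORKED PLACE FREY `p = 7`, `l = 107` (`e 1605`, `m 210`, `δ 1604`, `r_in 268`, `r_out −4472`, labels `1 … 53`; the TOPT worked place of record, LP-SPEC §S3: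
  `MM 10,707,060 · PP 9,374,578`): `placeNet (j ↦ j²) = −1,332,482 = PP − MM` (NOT closed within place under print: a budget-tight place, dual price 1;
  `worked_not_closesWithin_print`), `placeNet (j ↦ j) = 9,080,758` (closed under `κ = 1`; `worked_closesWithin_kappaOne`) — the two integers both D1 engines print.
HONEST FRAMING: integer bookkeeping about OUR typed cell with a free pilot law; every law other than `j²` is a HYPOTHETICAL parameter setting (REQB Part (II)
consistency words: NEW-THEORY / INCONSISTENT-as-printed), not a statement that [EtTh]/[IUTchI–III] define such Θ-data; «closes within place» is a property of
the typed LP (TOPT-LP-SPEC), located ≠ proved about IUT; nothing here asserts that abc is proved or refuted, or that [IUTchIII] Cor. 3.12 / [IUTchIV] Thm. 1.10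
holds or fails at any datum, or takes a side on any author; typed ≠ proved; computed ≠ proved. [claim: Mochizuki2012, status: disputed] for every IUT locution.
[cite: Mochizuki2012, IUTchIII Cor. 3.12 p. 173–174; IUTchIV Prop. 1.4 p. 13, Thm. 1.10 Step (v) p. 27–29]
-/

namespace Summit.ABC.IUTFork.Repair.RH.D1WithinPlaceNet

open Finset
open Summit.ABC.IUTFork.Repair.RH.ReqsideWeightLaws

/-! ## §1. The margin of the k1-cell and its antitonicity in the law -/

/-- **THE MARGIN of the k1-cell** at a place `(e, m, δ, r_in, r_out)` and label `j` under the pilot law `f/den`: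
`margin := m − (j+1)·r_out − e·⌊(f(j)·m − den·(j·δ + (j+1)·r_in))/(den·e)⌋` — TOPT-LP-SPEC v1.2 §S2 «margin_j» (= price_j − demand_j of the exact cell)
with REQB §6(b)'s law `f` in the pilot order. A parameterised READING of our hull cell, not an IUT object.
[cite: Mochizuki2012, IUTchIV Prop. 1.4 p. 13] [claim: Mochizuki2012, status: disputed] -/
@[claim "Mochizuki2012" "disputed"]
def margin (f : ℕ → ℤ) (den e m δ rin rout : ℤ) (j : ℕ) : ℤ :=
  m - ((j : ℤ) + 1) * rout - e * ((f j * m - den * ((j : ℤ) * δ + ((j : ℤ) + 1) * rin)) / (den * e))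

/-- **The cell is licensed iff its margin is nonnegative** (`ReqsideWeightLaws.Cell` unfolded). [folklore] -/
theorem cell_iff_margin_nonneg (f : ℕ → ℤ) (den e m δ rin rout : ℤ) (j : ℕ) :
    Cell f den e m δ rin rout j ↔ 0 ≤ margin f den e m δ rin rout j := by
  unfold Cell margin
  constructor
  · intro h; linarith
  · intro h; linarith

/-- The margin depends on the law only through its value at the label. [folklore] -/
theorem margin_congr {f g : ℕ → ℤ} {j : ℕ} (h : f j = g j) (den e m δ rin rout : ℤ) :
    margin f den e m δ rin rout j = margin g den e m δ rin rout j := by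
  unfold margin; rw [h]

/-- **PILOT ANTITONICITY OF THE MARGIN** (`den > 0`, `e > 0`, `m ≥ 0`): a larger pilot value can only lower the margin —
`f(j) ≤ g(j) ⟹ margin g ≤ margin f` (floor monotonicity). Refines `ReqsideWeightLaws.cell_of_le_of_cell` from the sign to the value. [folklore] -/
theorem margin_antitone {f g : ℕ → ℤ} {den e m δ rin rout : ℤ} (hden : 0 < den) (he : 0 < e) (hm : 0 ≤ m) {j : ℕ}
    (hfg : f j ≤ g j) : margin g den e m δ rin rout j ≤ margin f den e m δ rin rout j := by
  unfold margin
  have hle : f j * m - den * ((j : ℤ) * δ + ((j : ℤ) + 1) * rin) ≤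
      g j * m - den * ((j : ℤ) * δ + ((j : ℤ) + 1) * rin) := by
    nlinarith [mul_le_mul_of_nonneg_right hfg hm]
  have hdiv := Int.ediv_le_ediv (mul_pos hden he) hle
  nlinarith [mul_le_mul_of_nonneg_left hdiv he.le]

/-! ## §2. The place net, within-place closure, and the down-set theorem -/

/-- **THE PLACE NET** over the labels `1 … n`: `placeNet := Σ_{j=1}^{n} margin_j` — the place's price mass minus its trivial mass
(`PP_w − MM_w` of TOPT-LP-SPEC v1.2 §S2; `n = |J|`, print `n = l⋆`). A bookkeeping quantity of our typed cell currency.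
[cite: Mochizuki2012, IUTchIV Thm. 1.10 Step (v) p. 27–29] [claim: Mochizuki2012, status: disputed] -/
@[claim "Mochizuki2012" "disputed"]
def placeNet (f : ℕ → ℤ) (den e m δ rin rout : ℤ) (n : ℕ) : ℤ :=
  ∑ i ∈ Finset.range n, margin f den e m δ rin rout (i + 1)

/-- Recursion: `placeNet (n+1) = placeNet n + margin_{n+1}`. [folklore] -/
theorem placeNet_succ (f : ℕ → ℤ) (den e m δ rin rout : ℤ) (n : ℕ) :
    placeNet f den e m δ rin rout (n + 1) = placeNet f den e m δ rin rout n + margin f den e m δ rin rout (n + 1) := by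
  unfold placeNet; rw [Finset.sum_range_succ]

/-- `placeNet 0 = 0`. [folklore] -/
theorem placeNet_zero (f : ℕ → ℤ) (den e m δ rin rout : ℤ) : placeNet f den e m δ rin rout 0 = 0 := by
  unfold placeNet; simp

/-- **BOOKKEEPING IDENTITY**: for ANY demand assignment `d`, (Σ price) − (Σ demand) = placeNet when price_j := d_j + margin_j — i.e. `PP_w − MM_w`
is the net slack whatever the demand law (TOPT-LP-SPEC §S2 `PP = MM + CC − DD`). [folklore] -/
theorem priceSum_sub_demandSum_eq_placeNet (d : ℕ → ℤ) (f : ℕ → ℤ) (den e m δ rin rout : ℤ) (n : ℕ) :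
    (∑ i ∈ Finset.range n, (d (i + 1) + margin f den e m δ rin rout (i + 1))) - ∑ i ∈ Finset.range n, d (i + 1) =
      placeNet f den e m δ rin rout n := by
  unfold placeNet
  rw [Finset.sum_add_distrib]
  ring

/-- **PILOT ANTITONICITY OF THE PLACE NET**: `f ≤ g` on the labels `1 … n` (`den > 0`, `e > 0`, `m ≥ 0`) ⟹ `placeNet g ≤ placeNet f`. [folklore] -/
theorem placeNet_antitone {f g : ℕ → ℤ} {den e m δ rin rout : ℤ} (hden : 0 < den) (he : 0 < e) (hm : 0 ≤ m) {n : ℕ}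
    (hfg : ∀ j, 1 ≤ j → j ≤ n → f j ≤ g j) : placeNet g den e m δ rin rout n ≤ placeNet f den e m δ rin rout n := by
  unfold placeNet
  apply Finset.sum_le_sum
  intro i hi
  rw [Finset.mem_range] at hi
  exact margin_antitone hden he hm (hfg (i + 1) (by omega) (by omega))

/-! ### Within-place closure
«The place CLOSES WITHIN» := `0 ≤ placeNet` — in the typed LP of TOPT-LP-SPEC §S3 (EX information, WITHIN-place financing, free partial-credit
weights) the place keeps its whole mass iff its certified surplus covers its deficit, `CC_w ≥ DD_w ⟺ PP_w ≥ MM_w`; the round-3 AXIS-D1 «kept = 1 at the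
place» flag. Stated below always as the inequality `0 ≤ placeNet …` (no new `Prop` definition). -/

/-- **LP READING, tier L1a per place**: with `PP := MM + net`, the within-place kept mass `min(MM, PP)` equals the whole mass `MM` iff `0 ≤ net`.
[folklore] -/
theorem min_mass_price_eq_mass_iff (MM net : ℤ) : min MM (MM + net) = MM ↔ 0 ≤ net := by
  constructor
  · intro h
    have h2 : min MM (MM + net) ≤ MM + net := min_le_right MM (MM + net)
    rw [h] at h2
    linarith
  · intro h
    exact min_eq_left (by linarith)

/-- **LP READING, the shortfall**: `MM − min(MM, MM + net) = (−net)⁺` — the place's unfinanced deficit `(DD_w − CC_w)⁺` (the residual «ε» of the D1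
tables is the `u_w`-weighted sum of these over the budget-tight places). [folklore] -/
theorem mass_sub_min_eq_posPart (MM net : ℤ) : MM - min MM (MM + net) = max (-net) 0 := by
  rcases le_or_gt 0 net with h | h
  · rw [min_eq_left (by linarith), max_eq_right (by linarith)]; ring
  · rw [min_eq_right (by linarith), max_eq_left (by linarith)]; ring

/-- If every label `1 … n` is a cell (the place is wholly licensed), the place closes within (all margins `≥ 0`). [folklore] -/
theorem closesWithin_of_forall_cell {f : ℕ → ℤ} {den e m δ rin rout : ℤ} {n : ℕ}
    (h : ∀ j, 1 ≤ j → j ≤ n → Cell f den e m δ rin rout j) : 0 ≤ placeNet f den e m δ rin rout n := by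
  unfold placeNet
  apply Finset.sum_nonneg
  intro i hi
  rw [Finset.mem_range] at hi
  exact (cell_iff_margin_nonneg f den e m δ rin rout (i + 1)).mp (h (i + 1) (by omega) (by omega))

/-- **THE DOWN-SET THEOREM**: if a place closes within under the law `g`, it closes under every law `f ≤ g` on its labels (`den > 0`, `e > 0`,
`m ≥ 0`). [folklore] -/
theorem closesWithin_of_le {f g : ℕ → ℤ} {den e m δ rin rout : ℤ} (hden : 0 < den) (he : 0 < e) (hm : 0 ≤ m) {n : ℕ}
    (hfg : ∀ j, 1 ≤ j → j ≤ n → f j ≤ g j) (h : 0 ≤ placeNet g den e m δ rin rout n) :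
    0 ≤ placeNet f den e m δ rin rout n :=
  le_trans h (placeNet_antitone hden he hm hfg)

/-- **THE κ-SCAN IS A DOWN-SET IN THE EXPONENT**: for the κ-laws `⌈j^{a/2}⌉ = lawPow a` (`den = 1`), `a ≤ b` and closure under `lawPow b` give closure
under `lawPow a` (`ReqsideWeightLaws.lawPow_mono_exp`). So «the largest grid exponent at which the place closes» is well defined, and a datum's
one-flags along any increasing exponent grid are non-increasing — the property both D1 engines report on 133/133 FREY data. [folklore] -/
theorem closesWithin_lawPow_of_le {a b : ℕ} (hab : a ≤ b) {e m δ rin rout : ℤ} (he : 0 < e) (hm : 0 ≤ m) {n : ℕ}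
    (h : 0 ≤ placeNet (lawPow b) 1 e m δ rin rout n) : 0 ≤ placeNet (lawPow a) 1 e m δ rin rout n :=
  closesWithin_of_le one_pos he hm (fun _ hj _ => lawPow_mono_exp hj hab) h

/-- Contrapositive form used when reading a scan upward: NOT closed under `lawPow a` ⟹ NOT closed under any `lawPow b`, `b ≥ a`. [folklore] -/
theorem not_closesWithin_lawPow_of_le {a b : ℕ} (hab : a ≤ b) {e m δ rin rout : ℤ} (he : 0 < e) (hm : 0 ≤ m) {n : ℕ}
    (h : ¬ 0 ≤ placeNet (lawPow a) 1 e m δ rin rout n) : ¬ 0 ≤ placeNet (lawPow b) 1 e m δ rin rout n :=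
  fun hb => h (closesWithin_lawPow_of_le hab he hm hb)

/-! ## §3. Worked place FREY `p = 7`, `l = 107` (`e 1605`, `m 210`, `δ 1604`, `r_in 268`, `r_out −4472`, labels `1 … 53`) -/

/-- **WORKED PLACE, PRINT LAW**: `placeNet (j ↦ j²) = −1,332,482` (= `PP − MM = 9,374,578 − 10,707,060` of TOPT-LP-SPEC §S3's worked place; both D1 engines).
A computed row of OUR typed table re-derived in the kernel ≠ a theorem about IUT. [folklore] -/
theorem worked_placeNet_print :
    placeNet (fun j => (j : ℤ) ^ 2) 1 1605 210 1604 268 (-4472) 53 = -1332482 := by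
  simp only [placeNet, Finset.sum_range_succ, Finset.sum_range_zero, margin]
  norm_num

/-- Hence under print the worked place does NOT close within place (a budget-tight place: dual price `1` in the D1 LP). [folklore] -/
theorem worked_not_closesWithin_print :
    ¬ 0 ≤ placeNet (fun j => (j : ℤ) ^ 2) 1 1605 210 1604 268 (-4472) 53 := by
  rw [worked_placeNet_print]
  decide

/-- Its unfinanced deficit in place units: `MM − min(MM, PP) = 1,332,482` (`MM = 10,707,060`). [folklore] -/
theorem worked_shortfall_print :
    (10707060 : ℤ) - min 10707060 (10707060 + placeNet (fun j => (j : ℤ) ^ 2) 1 1605 210 1604 268 (-4472) 53) = 1332482 := by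
  rw [mass_sub_min_eq_posPart, worked_placeNet_print]
  decide

/-- **WORKED PLACE, `κ = 1`** (`f = j`): `placeNet = 9,080,758` (`PP 9,370,138 − MM 289,380`; both D1 engines). [folklore] -/
theorem worked_placeNet_kappaOne :
    placeNet (fun j => (j : ℤ)) 1 1605 210 1604 268 (-4472) 53 = 9080758 := by
  simp only [placeNet, Finset.sum_range_succ, Finset.sum_range_zero, margin]
  norm_num

/-- Hence under `κ = 1` the worked place closes within place (indeed every label is a cell, `ReqsideWeightLaws.worked_kappaOne_all`). [folklore] -/
theorem worked_closesWithin_kappaOne :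
    0 ≤ placeNet (fun j => (j : ℤ)) 1 1605 210 1604 268 (-4472) 53 := by
  rw [worked_placeNet_kappaOne]
  decide

/-- The same via `lawPow 2 = (j ↦ j)` (the κ-scan grid point `a = 2`). [folklore] -/
theorem worked_closesWithin_lawPow_two :
    0 ≤ placeNet (lawPow 2) 1 1605 210 1604 268 (-4472) 53 := by
  have h : placeNet (lawPow 2) 1 1605 210 1604 268 (-4472) 53 = placeNet (fun j => (j : ℤ)) 1 1605 210 1604 268 (-4472) 53 := by
    unfold placeNet
    refine Finset.sum_congr rfl (fun i _ => ?_)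
    exact margin_congr (lawPow_two (i + 1)) 1 1605 210 1604 268 (-4472)
  rw [h, worked_placeNet_kappaOne]
  decide

/-- And under print = `lawPow 4` the worked place does not close (grid point `a = 4`), so by the down-set theorem it closes under NO `lawPow b`, `b ≥ 4`.
[folklore] -/
theorem worked_not_closesWithin_lawPow_ge_four {b : ℕ} (hb : 4 ≤ b) :
    ¬ 0 ≤ placeNet (lawPow b) 1 1605 210 1604 268 (-4472) 53 := by
  have h4 : ¬ 0 ≤ placeNet (lawPow 4) 1 1605 210 1604 268 (-4472) 53 := by
    have h : placeNet (lawPow 4) 1 1605 210 1604 268 (-4472) 53 = placeNet (fun j => (j : ℤ) ^ 2) 1 1605 210 1604 268 (-4472) 53 := by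
      unfold placeNet
      refine Finset.sum_congr rfl (fun i _ => ?_)
      exact margin_congr (lawPow_four (i + 1)) 1 1605 210 1604 268 (-4472)
    rw [h, worked_placeNet_print]
    decide
  exact not_closesWithin_lawPow_of_le hb (by norm_num) (by norm_num) h4

end Summit.ABC.IUTFork.Repair.RH.D1WithinPlaceNet
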